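import Literature.NumberTheory.Transcendental.ZilberCategoricityOverUniv
import HarnessLib

/-!
# Homogeneity over closed sets across two Zilber fields in an arbitrary universe, by transfer to the countable model

M. Bays, J. Kirby, *Excellence and uncountable categoricity of Zilber's exponential fields*,
arXiv:1305.0493 (2013), Prop. 5 (Kirby's axiom II for `ECF_{SK,CCP}`) with the reduction of
§2.4 to the countable models; M. Bays, J. Kirby, Algebra & Number Theory 12 (2018), Thm 6.9;
J. Kirby, J. Symbolic Logic 75 (2010), Def. 1.1, Thm 2.1.

This is the universe-polymorphic form of `ZilberHomogeneityTransfer.lean` (see the introduction of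
`ZilberCategoricityOverUniv.lean` for why it is needed): the sections `Base`, `Bridge` and
`Transfer` of that file — isomorphism of two countable models over the base points
(`exists_equiv_base`), the bridge between Galois types over the base across two fields and
automorphisms of one countable model over `ecl ∅` (`eclIsoOver_of_baseAut`,
`exists_baseAut_of_eclIsoOver`), the frame (`exists_frame`) and Kirby's axiom II across two
UNCOUNTABLE Zilber fields (`eclIsoOver_append_of_notMem`, `exists_eclIsoOver_append_snoc`) —
with the fields `M, M', K, K'` and the base `P` in `Type u` instead of `Type`,
same statements and proofs. The preparatory sections `InfDim` and `Sub` of the original file are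
already universe-polymorphic and are used from there (`ZilberTransfer.*`), as are all engines
(`ZilberCountableIso.exists_equiv`, `ZilberHomogeneity.exists_exponentialRingEquiv_of_isEIsoOn`,
`SEACModel.*`; `EclIsoOver` with base in `Type u` is that of `ZilberCategoricityOverUniv.lean`).
Everything is proved; no named fact is introduced.

## References

* M. Bays, J. Kirby, arXiv:1305.0493 (2013): §2.1, §2.4, Prop. 5.
* M. Bays, J. Kirby, Algebra & Number Theory 12 (2018) 493–549: Def. 6.1, Remark 6.6, Thm 6.9.
* J. Kirby, *Finitely presented exponential fields*, Algebra & Number Theory 7 (2013): Cor. 6.10.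
* J. Kirby, *On quasiminimal excellent classes*, J. Symbolic Logic 75 (2010): Def. 1.1, Thm 2.1.
* M. Bays, B. Hart, T. Hyttinen, M. Kesälä, J. Kirby, Bull. LMS 46 (2014): Cor. 5.3.
-/

noncomputable section

open Set
open Literature.ModelTheory.ExponentialFields Literature.ModelTheory.ExponentialFields.ExponentialRing

universe u

namespace Literature.NumberTheory.Transcendental

namespace ZilberOverUniv

/-! ### Isomorphism of two countable models over the base points -/

section Base

variable {M : Type u} [Field M] [CharZero M] [ExponentialRing M]
variable {M' : Type u} [Field M'] [CharZero M'] [ExponentialRing M']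
variable {P : Type u} [Field P] [ExponentialRing P]

/-- **Two countable Zilber fields of infinite dimension are isomorphic over their base points**
(`ZilberCountableIso.exists_equiv`, followed by an automorphism of the target extending the
automorphism `ι' ∘ ι⁻¹ ∘ Φ₀⁻¹` of its prime model `ecl(∅)`: Kirby 2010, Thm 2.1 with Cor. 2.2, in
the form `ZilberHomogeneity.exists_exponentialRingEquiv_of_isEIsoOn`).
[cite: Kirby2013FPEF, Cor. 6.10] [cite: Kirby2010QMEC, Thm 2.1 and Cor. 2.2] -/
theorem exists_equiv_base [Countable M] [Countable M'] (hM : IsZilberField M) (hM' : IsZilberField M')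
    (hinf : ∀ C : Set M, C.Finite → ∃ d, d ∉ ecl C) (hinf' : ∀ C : Set M', C.Finite → ∃ d, d ∉ ecl C)
    (ι : ExponentialRingHom P M) (ι' : ExponentialRingHom P M')
    (hι : Set.range ι = ecl (∅ : Set M)) (hι' : Set.range ι' = ecl (∅ : Set M')) :
    ∃ Φ : ExponentialRingEquiv M M', ∀ p, Φ (ι p) = ι' p := by
  classical
  haveI := hM'.isAlgClosed
  obtain ⟨Φ₀⟩ := ZilberCountableIso.exists_equiv hM hM' hinf hinf'
  have hιinj : Function.Injective ι := ι.toRingHom.injective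
  have hι'inj : Function.Injective ι' := ι'.toRingHom.injective
  -- `ecl^{M'} ∅ = Φ₀ ι (P)`
  have hmem : ∀ w : M', w ∈ ecl (∅ : Set M') ↔ ∃ p, Φ₀ (ι p) = w := by
    intro w
    have e : ecl (∅ : Set M') = Φ₀ '' ecl (∅ : Set M) := by
      rw [Khovanskii.image_ecl_equiv Φ₀ ∅, Set.image_empty]
    rw [e, ← hι, ← Set.range_comp]
    rfl
  -- the correcting map on `ecl^{M'} ∅`
  let g : M' → M' := fun w => if h : ∃ p, Φ₀ (ι p) = w then ι' (Classical.choose h) else w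
  have hg : ∀ p, g (Φ₀ (ι p)) = ι' p := by
    intro p
    have h : ∃ q, Φ₀ (ι q) = Φ₀ (ι p) := ⟨p, rfl⟩
    simp only [g, dif_pos h]
    congr 1
    exact hιinj (Φ₀.injective (Classical.choose_spec h))
  have hgiso : IsEIsoOn g (ecl (Set.range (Fin.elim0 : Fin 0 → M')))
      (ecl (Set.range (Fin.elim0 : Fin 0 → M'))) := by
    have e0 : Set.range (Fin.elim0 : Fin 0 → M') = ∅ := Set.range_eq_empty _
    rw [e0]
    refine ⟨⟨?_, ?_, ?_⟩, ?_, ?_, ?_⟩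
    · intro w hw
      obtain ⟨p, rfl⟩ := (hmem w).1 hw
      rw [hg, ← hι']
      exact ⟨p, rfl⟩
    · intro w₁ hw₁ w₂ hw₂ h
      obtain ⟨p₁, rfl⟩ := (hmem w₁).1 hw₁
      obtain ⟨p₂, rfl⟩ := (hmem w₂).1 hw₂
      rw [hg, hg] at h
      rw [hι'inj h]
    · intro w hw
      rw [← hι'] at hw
      obtain ⟨p, rfl⟩ := hw
      exact ⟨Φ₀ (ι p), (hmem _).2 ⟨p, rfl⟩, hg p⟩
    · intro u v hu hv
      obtain ⟨p, rfl⟩ := (hmem u).1 hu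
      obtain ⟨q, rfl⟩ := (hmem v).1 hv
      rw [← map_add, ← map_add, hg, hg, hg, map_add]
    · intro u v hu hv
      obtain ⟨p, rfl⟩ := (hmem u).1 hu
      obtain ⟨q, rfl⟩ := (hmem v).1 hv
      rw [← map_mul, ← map_mul, hg, hg, hg, map_mul]
    · intro u hu
      obtain ⟨p, rfl⟩ := (hmem u).1 hu
      rw [← Φ₀.map_exp, ← ι.map_exp, hg, hg, ι'.map_exp]
  obtain ⟨ρ, hρ⟩ := ZilberHomogeneity.exists_exponentialRingEquiv_of_isEIsoOn
    hM'.isSurjectiveOntoUnits hM'.isStronglyExpAlgClosed hinf' hgiso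
  refine ⟨Φ₀.trans ρ, fun p => ?_⟩
  rw [ExponentialRingEquiv.trans_apply, hρ ?_, hg]
  rw [Set.range_eq_empty Fin.elim0]
  exact (hmem _).2 ⟨p, rfl⟩

end Base

/-! ### The bridge: Galois types over the base across two fields, and automorphisms of one
countable model over `ecl ∅` -/

section Bridge

variable {K : Type u} [Field K] [CharZero K] [ExponentialRing K]
variable {K' : Type u} [Field K'] [CharZero K'] [ExponentialRing K']
variable {P : Type u} [Field P] [ExponentialRing P]
variable {ι : ExponentialRingHom P K} {ι' : ExponentialRingHom P K'} {T : Set K} {T' : Set K'}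
variable (Φ : ExponentialRingEquiv (Khovanskii.eclSubfield T) (Khovanskii.eclSubfield T'))

omit [CharZero K] [CharZero K'] in
/-- **From an automorphism of the countable model over `ecl ∅` to an isomorphism of pointed
closures over the base points.** If `Φ : ecl T ≅ ecl T'` respects the base points and
`ρ ∈ Aut(ecl T' / ecl ∅)` maps `Φ u ↦ u'`, then `ρ ∘ Φ` restricts to
`(ecl^K(u), u) ≅ (ecl^{K'}(u'), u')` over the base points. [cite: Kirby2010QMEC, Lemma 1.3]
[cite: BaysKirby2018ANT, Remark 6.6] -/
theorem eclIsoOver_of_baseAut (hι' : Set.range ι' = ecl (∅ : Set K'))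
    (hΦ : ∀ (p : P) (h : ι p ∈ Khovanskii.eclSubfield T),
      ((Φ ⟨ι p, h⟩ : Khovanskii.eclSubfield T') : K') = ι' p)
    {k : ℕ} {u : Fin k → K} {u' : Fin k → K'} (hu : ∀ i, u i ∈ Khovanskii.eclSubfield T)
    (hu' : ∀ i, u' i ∈ Khovanskii.eclSubfield T') {ρ : Equiv.Perm (Khovanskii.eclSubfield T')}
    (hρ : ρ ∈ SEACModel.baseAut (∅ : Set (Khovanskii.eclSubfield T')))
    (hρu : ∀ i, ρ (Φ ⟨u i, hu i⟩) = ⟨u' i, hu' i⟩) : EclIsoOver ι ι' u u' := by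
  classical
  obtain ⟨ρE, hρE⟩ := SEACModel.exists_equiv_of_mem_baseAut hρ
  have hsub : ecl (Set.range u) ⊆ ecl T :=
    ecl_subset_ecl_of_subset (by rintro _ ⟨i, rfl⟩; exact hu i)
  have hsub' : ecl (Set.range u') ⊆ ecl T' :=
    ecl_subset_ecl_of_subset (by rintro _ ⟨i, rfl⟩; exact hu' i)
  have hincl : ∀ (z : Khovanskii.eclSubfield (Set.range u)) (h : (z : K) ∈ Khovanskii.eclSubfield T),
      Khovanskii.eclSubfield.inclusionE hsub z = ⟨(z : K), h⟩ := fun z h =>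
    Subtype.ext (Khovanskii.eclSubfield.coe_inclusionE_apply hsub z)
  let ψ : ExponentialRingHom (Khovanskii.eclSubfield (Set.range u)) K' :=
    (Khovanskii.eclSubfield.eHom T').comp
      (ρE.toExponentialRingHom.comp (Φ.toExponentialRingHom.comp
        (Khovanskii.eclSubfield.inclusionE hsub)))
  have hψ : ∀ z, ψ z = ((ρ (Φ (Khovanskii.eclSubfield.inclusionE hsub z)) :
      Khovanskii.eclSubfield T') : K') := fun z => by
    simp only [ψ, ExponentialRingHom.comp_apply, ExponentialRingEquiv.toExponentialRingHom_apply,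
      Khovanskii.eclSubfield.eHom_apply, hρE]
  -- `ecl (range u'M') = ρ (Φ (ecl (range uM)))`
  have e0 : (fun i => (⟨u' i, hu' i⟩ : Khovanskii.eclSubfield T')) =
      ⇑ρ ∘ ⇑Φ ∘ fun i => (⟨u i, hu i⟩ : Khovanskii.eclSubfield T) := funext fun i => (hρu i).symm
  have e1 : ecl (Set.range fun i => (⟨u' i, hu' i⟩ : Khovanskii.eclSubfield T')) =
      ρ '' (Φ '' ecl (Set.range fun i => (⟨u i, hu i⟩ : Khovanskii.eclSubfield T))) := by
    rw [Khovanskii.image_ecl_equiv, SEACModel.image_ecl_of_mem_baseAut hρ, ← Set.range_comp,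
      ← Set.range_comp, e0]
  refine ⟨ψ, ?_, fun i => ?_, fun p h => ?_⟩
  · ext w
    constructor
    · rintro ⟨z, rfl⟩
      rw [hψ]
      have h1 : Khovanskii.eclSubfield.inclusionE hsub z ∈
          ecl (Set.range fun i => (⟨u i, hu i⟩ : Khovanskii.eclSubfield T)) := by
        rw [ZilberTransfer.mem_ecl_range_mk_iff, Khovanskii.eclSubfield.coe_inclusionE_apply]; exact z.2
      have h3 : ρ (Φ (Khovanskii.eclSubfield.inclusionE hsub z)) ∈
          ecl (Set.range fun i => (⟨u' i, hu' i⟩ : Khovanskii.eclSubfield T')) := by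
        rw [e1]
        exact Set.mem_image_of_mem ρ (Set.mem_image_of_mem Φ h1)
      exact (ZilberTransfer.mem_ecl_range_mk_iff u' hu' _).1 h3
    · intro hw
      have hwT' : w ∈ Khovanskii.eclSubfield T' := hsub' hw
      have h3 : (⟨w, hwT'⟩ : Khovanskii.eclSubfield T') ∈
          ecl (Set.range fun i => (⟨u' i, hu' i⟩ : Khovanskii.eclSubfield T')) := by
        rw [ZilberTransfer.mem_ecl_range_mk_iff]; exact hw
      rw [e1] at h3
      obtain ⟨_, ⟨z, hz, rfl⟩, hzw⟩ := h3
      have hzu : (z : K) ∈ ecl (Set.range u) := (ZilberTransfer.mem_ecl_range_mk_iff u hu z).1 hz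
      refine ⟨⟨z, hzu⟩, ?_⟩
      rw [hψ, hincl ⟨z, hzu⟩ z.2, hzw]
  · rw [hψ, hincl _ (hu i), hρu]
  · have hT : ι p ∈ Khovanskii.eclSubfield T := hsub h
    rw [hψ, hincl ⟨ι p, h⟩ hT]
    have hw : Φ ⟨ι p, hT⟩ ∈ ecl (∅ : Set (Khovanskii.eclSubfield T')) := by
      rw [ZilberTransfer.mem_ecl_empty_sub_iff, hΦ, ← hι']
      exact ⟨p, rfl⟩
    rw [SEACModel.apply_eq_of_mem_baseAut hρ hw, hΦ]

/-- **From an isomorphism of pointed closures over the base points to an automorphism of the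
countable model over `ecl ∅`.** If `Φ : ecl T ≅ ecl T'` respects the base points (whose images are
the `ecl(∅)`'s), the model `ecl T'` is a countable Zilber field of infinite dimension, and
`(ecl^K(u), u) ≅ (ecl^{K'}(u'), u')` over the base points for tuples `u ⊆ ecl T`, `u' ⊆ ecl T'`,
then some `ρ ∈ Aut(ecl T' / ecl ∅)` maps `Φ u ↦ u'`: the isomorphism, conjugated by `Φ`, is an
isomorphism of closures of finite tuples of `ecl T'` fixing `ecl ∅` pointwise, hence the
restriction of such an automorphism (`SEACModel.exists_mem_baseAut_of_isEIsoOn`: Bays–Kirby 2018,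
Thm 6.9, proof of QM5a, "since `M` is `𝒞^{fg}`-homogeneous").
[cite: BaysKirby2018ANT, Thm 6.9 (proof) and Remark 6.6] [cite: Kirby2010QMEC, Thm 2.1] -/
theorem exists_baseAut_of_eclIsoOver [Countable (Khovanskii.eclSubfield T')]
    (hM' : IsZilberField (Khovanskii.eclSubfield T'))
    (hinf' : ∀ C : Set (Khovanskii.eclSubfield T'), C.Finite → ∃ d, d ∉ ecl C)
    (hι : Set.range ι = ecl (∅ : Set K)) (hι' : Set.range ι' = ecl (∅ : Set K'))
    (hΦ : ∀ (p : P) (h : ι p ∈ Khovanskii.eclSubfield T),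
      ((Φ ⟨ι p, h⟩ : Khovanskii.eclSubfield T') : K') = ι' p)
    {k : ℕ} {u : Fin k → K} {u' : Fin k → K'} (hu : ∀ i, u i ∈ Khovanskii.eclSubfield T)
    (hu' : ∀ i, u' i ∈ Khovanskii.eclSubfield T') (h : EclIsoOver ι ι' u u') :
    ∃ ρ ∈ SEACModel.baseAut (∅ : Set (Khovanskii.eclSubfield T')),
      ∀ i, ρ (Φ ⟨u i, hu i⟩) = ⟨u' i, hu' i⟩ := by
  classical
  haveI := hM'.isAlgClosed
  obtain ⟨ψ, hψ, hψu, hψb⟩ := h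
  have hψinj : Function.Injective ψ := ψ.toRingHom.injective
  have hsub' : ecl (Set.range u') ⊆ ecl T' :=
    ecl_subset_ecl_of_subset (by rintro _ ⟨i, rfl⟩; exact hu' i)
  have hψT' : ∀ z, ψ z ∈ Khovanskii.eclSubfield T' := fun z => by
    have : ψ z ∈ ecl (Set.range u') := by rw [← hψ]; exact ⟨z, rfl⟩
    exact hsub' this
  have hzT : ∀ z : Khovanskii.eclSubfield (Set.range u), (z : K) ∈ Khovanskii.eclSubfield T := fun z =>
    ecl_subset_ecl_of_subset (by rintro _ ⟨i, rfl⟩; exact hu i) z.2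
  -- the conjugated map on the countable model
  let g : Khovanskii.eclSubfield T' → Khovanskii.eclSubfield T' := fun w =>
    if hw : ((Φ.symm w : Khovanskii.eclSubfield T) : K) ∈ ecl (Set.range u) then
      ⟨ψ ⟨_, hw⟩, hψT' _⟩ else w
  have hgval : ∀ z : Khovanskii.eclSubfield (Set.range u),
      g (Φ ⟨z, hzT z⟩) = ⟨ψ z, hψT' z⟩ := by
    intro z
    have hw : ((Φ.symm (Φ ⟨z, hzT z⟩) : Khovanskii.eclSubfield T) : K) ∈ ecl (Set.range u) := by
      rw [Φ.symm_apply_apply]; exact z.2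
    have e : g (Φ ⟨z, hzT z⟩) = ⟨ψ ⟨_, hw⟩, hψT' _⟩ := by simp only [g, dif_pos hw]
    rw [e]
    refine Subtype.ext ?_
    change ψ _ = ψ z
    congr 1
    exact Subtype.ext (by simp only [Φ.symm_apply_apply])
  have hgvalK : ∀ z : Khovanskii.eclSubfield (Set.range u),
      ((g (Φ ⟨z, hzT z⟩) : Khovanskii.eclSubfield T') : K') = ψ z := fun z =>
    congrArg Subtype.val (hgval z)
  -- the two closures and the shape of their elements
  have hA : ∀ w, w ∈ ecl (Set.range fun i => Φ ⟨u i, hu i⟩) →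
      ∃ z : Khovanskii.eclSubfield (Set.range u), Φ ⟨z, hzT z⟩ = w := by
    intro w hw
    have e : ecl (Set.range fun i => Φ ⟨u i, hu i⟩) =
        Φ '' ecl (Set.range fun i => (⟨u i, hu i⟩ : Khovanskii.eclSubfield T)) := by
      rw [Khovanskii.image_ecl_equiv, ← Set.range_comp]; rfl
    rw [e] at hw
    obtain ⟨z₀, hz₀, rfl⟩ := hw
    have hz₀u : (z₀ : K) ∈ ecl (Set.range u) := (ZilberTransfer.mem_ecl_range_mk_iff u hu z₀).1 hz₀
    exact ⟨⟨z₀, hz₀u⟩, rfl⟩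
  have hA' : ∀ z : Khovanskii.eclSubfield (Set.range u),
      Φ ⟨z, hzT z⟩ ∈ ecl (Set.range fun i => Φ ⟨u i, hu i⟩) := by
    intro z
    have e : ecl (Set.range fun i => Φ ⟨u i, hu i⟩) =
        Φ '' ecl (Set.range fun i => (⟨u i, hu i⟩ : Khovanskii.eclSubfield T)) := by
      rw [Khovanskii.image_ecl_equiv, ← Set.range_comp]; rfl
    rw [e]
    exact Set.mem_image_of_mem Φ ((ZilberTransfer.mem_ecl_range_mk_iff u hu _).2 z.2)
  have hB : ∀ w : Khovanskii.eclSubfield T',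
      w ∈ ecl (Set.range fun i => (⟨u' i, hu' i⟩ : Khovanskii.eclSubfield T')) ↔ (w : K') ∈ Set.range ψ := by
    intro w
    rw [ZilberTransfer.mem_ecl_range_mk_iff, hψ]
  -- `g` is an isomorphism of closures fixing `ecl ∅` pointwise
  have hiso : IsEIsoOn g (ecl (∅ ∪ Set.range fun i => Φ ⟨u i, hu i⟩))
      (ecl (∅ ∪ Set.range fun i => (⟨u' i, hu' i⟩ : Khovanskii.eclSubfield T'))) := by
    rw [Set.empty_union, Set.empty_union]
    refine ⟨⟨?_, ?_, ?_⟩, ?_, ?_, ?_⟩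
    · intro w hw
      obtain ⟨z, rfl⟩ := hA w hw
      rw [hB, hgvalK]
      exact ⟨z, rfl⟩
    · intro w₁ hw₁ w₂ hw₂ heq
      obtain ⟨z₁, rfl⟩ := hA w₁ hw₁
      obtain ⟨z₂, rfl⟩ := hA w₂ hw₂
      have h12 : ψ z₁ = ψ z₂ := by rw [← hgvalK, ← hgvalK, heq]
      have : z₁ = z₂ := hψinj h12
      subst this
      rfl
    · intro w' hw'
      obtain ⟨z, hz⟩ := (hB w').1 hw'
      refine ⟨Φ ⟨z, hzT z⟩, hA' z, Subtype.ext ?_⟩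
      rw [hgvalK, hz]
    · intro w₁ w₂ hw₁ hw₂
      obtain ⟨z₁, rfl⟩ := hA w₁ hw₁
      obtain ⟨z₂, rfl⟩ := hA w₂ hw₂
      have e : Φ ⟨z₁, hzT z₁⟩ + Φ ⟨z₂, hzT z₂⟩ = Φ ⟨((z₁ + z₂ : _) : K), hzT (z₁ + z₂)⟩ := by
        rw [← map_add]; rfl
      refine Subtype.ext ?_
      rw [AddMemClass.coe_add, e, hgvalK, hgvalK, hgvalK, map_add]
    · intro w₁ w₂ hw₁ hw₂
      obtain ⟨z₁, rfl⟩ := hA w₁ hw₁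
      obtain ⟨z₂, rfl⟩ := hA w₂ hw₂
      have e : Φ ⟨z₁, hzT z₁⟩ * Φ ⟨z₂, hzT z₂⟩ = Φ ⟨((z₁ * z₂ : _) : K), hzT (z₁ * z₂)⟩ := by
        rw [← map_mul]; rfl
      refine Subtype.ext ?_
      rw [MulMemClass.coe_mul, e, hgvalK, hgvalK, hgvalK, map_mul]
    · intro w hw
      obtain ⟨z, rfl⟩ := hA w hw
      have e : exp (Φ ⟨z, hzT z⟩) = Φ ⟨((exp z : _) : K), hzT (exp z)⟩ := by
        rw [← Φ.map_exp]; rfl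
      refine Subtype.ext ?_
      rw [Khovanskii.eclSubfield.coe_exp, e, hgvalK, hgvalK, ψ.map_exp]
  have hfix : ∀ w ∈ ecl (∅ : Set (Khovanskii.eclSubfield T')), g w = w := by
    intro w hw
    have hwK : (w : K') ∈ Set.range ι' := by rw [hι']; exact (ZilberTransfer.mem_ecl_empty_sub_iff w).1 hw
    obtain ⟨p, hp⟩ := hwK
    have hιp : ι p ∈ ecl (Set.range u) :=
      ecl_mono (Set.empty_subset _) (by rw [← hι]; exact ⟨p, rfl⟩)
    let z : Khovanskii.eclSubfield (Set.range u) := ⟨ι p, hιp⟩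
    have hzw : Φ ⟨z, hzT z⟩ = w := Subtype.ext (by rw [← hp]; exact hΦ p (hzT z))
    rw [← hzw, hgval]
    exact Subtype.ext (by rw [hzw, ← hp]; exact hψb p hιp)
  have hgx : ∀ i, g (Φ ⟨u i, hu i⟩) = ⟨u' i, hu' i⟩ := by
    intro i
    let z : Khovanskii.eclSubfield (Set.range u) := ⟨u i, subset_ecl _ (Set.mem_range_self i)⟩
    have : (⟨u i, hu i⟩ : Khovanskii.eclSubfield T) = ⟨z, hzT z⟩ := rfl
    rw [this, hgval]
    exact Subtype.ext (hψu i)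
  obtain ⟨σ, hσ, hσx⟩ := SEACModel.exists_mem_baseAut_of_isEIsoOn hM'.isSurjectiveOntoUnits
    hM'.isStronglyExpAlgClosed hinf' Set.finite_empty hiso hfix hgx
  exact ⟨σ, hσ, fun i => congrFun hσx i⟩

end Bridge

/-! ### Axiom II across two uncountable Zilber fields -/

section Transfer

variable {K : Type u} [Field K] [CharZero K] [ExponentialRing K]
variable {K' : Type u} [Field K'] [CharZero K'] [ExponentialRing K']
variable {P : Type u} [Field P] [ExponentialRing P]
variable {ι : ExponentialRingHom P K} {ι' : ExponentialRingHom P K'}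

/-- **The frame of the transfer**: countable closed models `ecl T ⊆ K`, `ecl T' ⊆ K'` of infinite
dimension containing given countable sets, with `ecl T'` a countable Zilber field of infinite
dimension (`IsZilberField.eclSubfield_isZilberField`), identified over the base points by an
isomorphism `Φ` (`exists_equiv_base`). [cite: BaysKirby2013Excellence, §2.4]
[cite: Kirby2013FPEF, Cor. 6.10] -/
theorem exists_frame (hK : IsZilberField K) (hK' : IsZilberField K')
    (hKu : ¬ (Set.univ : Set K).Countable) (hK'u : ¬ (Set.univ : Set K').Countable)
    (hι : Set.range ι = ecl (∅ : Set K)) (hι' : Set.range ι' = ecl (∅ : Set K'))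
    {S : Set K} {S' : Set K'} (hS : S.Countable) (hS' : S'.Countable) :
    ∃ (T : Set K) (T' : Set K'), S ⊆ T ∧ S' ⊆ T' ∧ (ecl T').Countable ∧
      IsZilberField (Khovanskii.eclSubfield T') ∧
      (∀ C : Set (Khovanskii.eclSubfield T'), C.Finite → ∃ d, d ∉ ecl C) ∧
      ∃ Φ : ExponentialRingEquiv (Khovanskii.eclSubfield T) (Khovanskii.eclSubfield T'),
        ∀ (p : P) (h : ι p ∈ Khovanskii.eclSubfield T),
          ((Φ ⟨ι p, h⟩ : Khovanskii.eclSubfield T') : K') = ι' p := by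
  classical
  obtain ⟨T, hST, hTc, hTinf⟩ := ZilberTransfer.exists_countable_infDim hK.hasCountableClosureProperty
    (ZilberTransfer.exists_notMem_ecl_of_not_countable hK.hasCountableClosureProperty hKu) hS
  obtain ⟨T', hS'T', hT'c, hT'inf⟩ := ZilberTransfer.exists_countable_infDim hK'.hasCountableClosureProperty
    (ZilberTransfer.exists_notMem_ecl_of_not_countable hK'.hasCountableClosureProperty hK'u) hS'
  haveI := ZilberTransfer.countable_sub hTc
  haveI := ZilberTransfer.countable_sub hT'c
  have hM : IsZilberField (Khovanskii.eclSubfield T) := hK.eclSubfield_isZilberField T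
  have hM' : IsZilberField (Khovanskii.eclSubfield T') := hK'.eclSubfield_isZilberField T'
  have hinf := ZilberTransfer.infDim_sub hTinf
  have hinf' := ZilberTransfer.infDim_sub hT'inf
  -- the base points of the models
  have hιT : ∀ p, ι p ∈ ecl T := fun p =>
    ecl_mono (Set.empty_subset _) (by rw [← hι]; exact ⟨p, rfl⟩)
  have hι'T' : ∀ p, ι' p ∈ ecl T' := fun p =>
    ecl_mono (Set.empty_subset _) (by rw [← hι']; exact ⟨p, rfl⟩)
  set ιM := ExponentialRingHom.codRestrictEcl ι T hιT with hιM
  set ιM' := ExponentialRingHom.codRestrictEcl ι' T' hι'T' with hιM'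
  have hrange : Set.range ιM = ecl (∅ : Set (Khovanskii.eclSubfield T)) := by
    ext z
    rw [ZilberTransfer.mem_ecl_empty_sub_iff, ← hι]
    constructor
    · rintro ⟨p, rfl⟩; exact ⟨p, rfl⟩
    · rintro ⟨p, hp⟩; exact ⟨p, Subtype.ext hp⟩
  have hrange' : Set.range ιM' = ecl (∅ : Set (Khovanskii.eclSubfield T')) := by
    ext z
    rw [ZilberTransfer.mem_ecl_empty_sub_iff, ← hι']
    constructor
    · rintro ⟨p, rfl⟩; exact ⟨p, rfl⟩
    · rintro ⟨p, hp⟩; exact ⟨p, Subtype.ext hp⟩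
  obtain ⟨Φ, hΦ⟩ := exists_equiv_base hM hM' hinf hinf' ιM ιM' hrange hrange'
  refine ⟨T, T', hST, hS'T', hT'c, hM', hinf', Φ, fun p h => ?_⟩
  have e : (⟨ι p, h⟩ : Khovanskii.eclSubfield T) = ιM p := Subtype.ext rfl
  rw [e, hΦ]
  rfl

/-- **Axiom II.1 across two Zilber fields: uniqueness of the generic type over a countable closed
set** (Kirby 2010, Def. 1.1, II.1; Bays–Kirby 2013, Prop. 5 (i); Haykazyan 2016, Def. 2, 4(i)),
for Galois types over the base: let `K`, `K'` be uncountable Zilber fields with base points onto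
their prime models, `G ⊆ K` countable and `ecl`-closed, `g` a map whose restrictions to finite
tuples of `G` are isomorphisms of pointed closures over the base points and with `g(G)`
`ecl`-closed; if `x ∉ G` and `x' ∉ g(G)`, then `(a, x) ↦ (g a, x')` is an isomorphism of pointed
closures over the base points for every finite tuple `a` from `G`. Proof: transfer to the countable
model (`exists_frame`, the bridge) and the uniqueness of the generic type over finite sets there
(`SEACModel.exists_mem_baseAut_apply_eq_of_notMem`, Bays–Kirby 2018 Thm 6.9, QM4).
[cite: BaysKirby2013Excellence, Prop. 5 (i)] [cite: Kirby2010QMEC, Def. 1.1 (axiom II.1)]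
[cite: BaysKirby2018ANT, Thm 6.9 (QM4)] -/
theorem eclIsoOver_append_of_notMem (hK : IsZilberField K) (hK' : IsZilberField K')
    (hKu : ¬ (Set.univ : Set K).Countable) (hK'u : ¬ (Set.univ : Set K').Countable)
    (hι : Set.range ι = ecl (∅ : Set K)) (hι' : Set.range ι' = ecl (∅ : Set K'))
    {G : Set K} (hGc : G.Countable) (hG : ecl G = G) {g : K → K'} (hgG : ecl (g '' G) = g '' G)
    (hpe : ∀ ⦃k : ℕ⦄ (a : Fin k → K), (∀ i, a i ∈ G) → EclIsoOver ι ι' a (g ∘ a))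
    {x : K} {x' : K'} (hx : x ∉ G) (hx' : x' ∉ g '' G)
    ⦃k : ℕ⦄ (a : Fin k → K) (ha : ∀ i, a i ∈ G) :
    EclIsoOver ι ι' (Fin.append a ![x]) (Fin.append (g ∘ a) ![x']) := by
  classical
  obtain ⟨T, T', hST, hS'T', hT'c, hM', hinf', Φ, hΦ⟩ := exists_frame hK hK' hKu hK'u hι hι'
    (S := insert x G) (S' := insert x' (g '' G)) (hGc.insert x) ((hGc.image g).insert x')
  haveI := ZilberTransfer.countable_sub hT'c
  haveI := hM'.isAlgClosed
  -- memberships in the models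
  have hGT : ∀ z ∈ G, z ∈ Khovanskii.eclSubfield T := fun z hz =>
    subset_ecl _ (hST (Set.mem_insert_of_mem _ hz))
  have hxT : x ∈ Khovanskii.eclSubfield T := subset_ecl _ (hST (Set.mem_insert _ _))
  have hG'T' : ∀ z ∈ G, g z ∈ Khovanskii.eclSubfield T' := fun z hz =>
    subset_ecl _ (hS'T' (Set.mem_insert_of_mem _ (Set.mem_image_of_mem g hz)))
  have hx'T' : x' ∈ Khovanskii.eclSubfield T' := subset_ecl _ (hS'T' (Set.mem_insert _ _))
  have hu : ∀ j, Fin.append a ![x] j ∈ Khovanskii.eclSubfield T := fun j => by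
    refine Fin.addCases (fun i => ?_) (fun i => ?_) j
    · rw [Fin.append_left]; exact hGT _ (ha i)
    · rw [Fin.append_right]; fin_cases i; exact hxT
  have hu' : ∀ j, Fin.append (g ∘ a) ![x'] j ∈ Khovanskii.eclSubfield T' := fun j => by
    refine Fin.addCases (fun i => ?_) (fun i => ?_) j
    · rw [Fin.append_left]; exact hG'T' _ (ha i)
    · rw [Fin.append_right]; fin_cases i; exact hx'T'
  -- Step 1: an automorphism over `ecl ∅` matching `Φ a ↦ g a`
  obtain ⟨ρ₀, hρ₀, hρ₀a⟩ := exists_baseAut_of_eclIsoOver Φ hM' hinf' hι hι' hΦ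
    (fun i => hGT _ (ha i)) (fun i => hG'T' _ (ha i)) (hpe a ha)
  -- Step 2: the two generic points over `g a`
  have ey : (Set.range fun i => (⟨g (a i), hG'T' _ (ha i)⟩ : Khovanskii.eclSubfield T')) =
      ρ₀ '' (Φ '' Set.range fun i => (⟨a i, hGT _ (ha i)⟩ : Khovanskii.eclSubfield T)) := by
    rw [← Set.range_comp, ← Set.range_comp]
    exact congrArg Set.range (funext fun i => (hρ₀a i).symm)
  have hw : ρ₀ (Φ ⟨x, hxT⟩) ∉
      ecl (∅ ∪ Set.range fun i => (⟨g (a i), hG'T' _ (ha i)⟩ : Khovanskii.eclSubfield T')) := by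
    rw [Set.empty_union, ey, ← SEACModel.image_ecl_of_mem_baseAut hρ₀, ← Khovanskii.image_ecl_equiv]
    rintro ⟨_, ⟨z, hz, rfl⟩, hzx⟩
    have hzx' : z = ⟨x, hxT⟩ := Φ.injective (ρ₀.injective hzx)
    subst hzx'
    have : x ∈ ecl (Set.range a) := (ZilberTransfer.mem_ecl_range_mk_iff a (fun i => hGT _ (ha i)) _).1 hz
    refine hx ?_
    rw [← hG]
    exact ecl_subset_ecl_of_subset (by rintro _ ⟨i, rfl⟩; exact subset_ecl _ (ha i)) this
  have hw' : (⟨x', hx'T'⟩ : Khovanskii.eclSubfield T') ∉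
      ecl (∅ ∪ Set.range fun i => (⟨g (a i), hG'T' _ (ha i)⟩ : Khovanskii.eclSubfield T')) := by
    rw [Set.empty_union]
    intro hmem
    have : x' ∈ ecl (Set.range (g ∘ a)) := (ZilberTransfer.mem_ecl_range_mk_iff (g ∘ a) (fun i => hG'T' _ (ha i)) _).1 hmem
    refine hx' ?_
    rw [← hgG]
    exact ecl_subset_ecl_of_subset
      (by rintro _ ⟨i, rfl⟩; exact subset_ecl _ (Set.mem_image_of_mem g (ha i))) this
  obtain ⟨σ, hσ, hσfix, hσx⟩ := SEACModel.exists_mem_baseAut_apply_eq_of_notMem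
    hM'.isSurjectiveOntoUnits hM'.isStronglyExpAlgClosed hinf' Set.finite_empty
    (fun i => (⟨g (a i), hG'T' _ (ha i)⟩ : Khovanskii.eclSubfield T')) hw hw'
  -- Step 3: `σ ∘ ρ₀` matches `Φ (a, x) ↦ (g a, x')`
  refine eclIsoOver_of_baseAut Φ hι' hΦ hu hu' (Subgroup.mul_mem _ hσ hρ₀) fun j => ?_
  refine Fin.addCases (fun i => ?_) (fun i => ?_) j
  · have e1 : (⟨Fin.append a ![x] (Fin.castAdd 1 i), hu _⟩ : Khovanskii.eclSubfield T) =
        ⟨a i, hGT _ (ha i)⟩ := Subtype.ext (by simp)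
    rw [e1, Equiv.Perm.mul_apply, hρ₀a, hσfix]
    exact Subtype.ext (by simp)
  · have e1 : (⟨Fin.append a ![x] (Fin.natAdd k i), hu _⟩ : Khovanskii.eclSubfield T) = ⟨x, hxT⟩ :=
      Subtype.ext (by fin_cases i; simp)
    rw [e1, Equiv.Perm.mul_apply, hσx]
    exact Subtype.ext (by fin_cases i; simp)

/-- **Axiom II.2 across two Zilber fields: `ℵ₀`-homogeneity over a countable closed set** (Kirby
2010, Def. 1.1, II.2; Bays–Kirby 2013, Prop. 5 (ii); Haykazyan 2016, Def. 2, 4(ii)), for Galois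
types over the base: with `K`, `K'`, `G` as in `eclIsoOver_append_of_notMem` and any map `g`, if
`(a, x) ↦ (g a, x')` is an isomorphism of pointed closures over the base points for every finite
tuple `a` from `G` and `y ∈ ecl(G, x)`, then there is `y'` such that `(a, x, y) ↦ (g a, x', y')` is
one for every finite `a` from `G`. Proof: transfer to the countable model (`exists_frame`, the
bridge) and `ℵ₀`-homogeneity over closed sets there (`SEACModel.homogeneity_over_closed`,
Bays–Kirby 2018 Thm 6.9 QM5 / BHHKK 2014 Cor. 5.3, for the closed set `Φ(G)` and the map
transported from `g`). [cite: BaysKirby2013Excellence, Prop. 5 (ii)]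
[cite: Kirby2010QMEC, Def. 1.1 (axiom II.2)] [cite: BaysKirby2018ANT, Thm 6.9 (QM5)] -/
theorem exists_eclIsoOver_append_snoc (hK : IsZilberField K) (hK' : IsZilberField K')
    (hKu : ¬ (Set.univ : Set K).Countable) (hK'u : ¬ (Set.univ : Set K').Countable)
    (hι : Set.range ι = ecl (∅ : Set K)) (hι' : Set.range ι' = ecl (∅ : Set K'))
    {G : Set K} (hGc : G.Countable) (hG : ecl G = G) {g : K → K'}
    {n : ℕ} {x : Fin n → K} {x' : Fin n → K'}
    (hxx' : ∀ ⦃k : ℕ⦄ (a : Fin k → K), (∀ i, a i ∈ G) →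
      EclIsoOver ι ι' (Fin.append a x) (Fin.append (g ∘ a) x'))
    {y : K} (hy : y ∈ ecl (G ∪ Set.range x)) :
    ∃ y' : K', ∀ ⦃k : ℕ⦄ (a : Fin k → K), (∀ i, a i ∈ G) →
      EclIsoOver ι ι' (Fin.append a (Fin.snoc x y : Fin (n + 1) → K))
        (Fin.append (g ∘ a) (Fin.snoc x' y' : Fin (n + 1) → K')) := by
  classical
  obtain ⟨T, T', hST, hS'T', hT'c, hM', hinf', Φ, hΦ⟩ := exists_frame hK hK' hKu hK'u hι hι'
    (S := insert y (G ∪ Set.range x)) (S' := g '' G ∪ Set.range x')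
    ((hGc.union (Set.countable_range x)).insert y) ((hGc.image g).union (Set.countable_range x'))
  haveI := ZilberTransfer.countable_sub hT'c
  haveI := hM'.isAlgClosed
  -- memberships in the models
  have hGT : ∀ z ∈ G, z ∈ Khovanskii.eclSubfield T := fun z hz =>
    subset_ecl _ (hST (Set.mem_insert_of_mem _ (Or.inl hz)))
  have hxT : ∀ j, x j ∈ Khovanskii.eclSubfield T := fun j =>
    subset_ecl _ (hST (Set.mem_insert_of_mem _ (Or.inr ⟨j, rfl⟩)))
  have hyT : y ∈ Khovanskii.eclSubfield T := subset_ecl _ (hST (Set.mem_insert _ _))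
  have hG'T' : ∀ z ∈ G, g z ∈ Khovanskii.eclSubfield T' := fun z hz =>
    subset_ecl _ (hS'T' (Or.inl (Set.mem_image_of_mem g hz)))
  have hx'T' : ∀ j, x' j ∈ Khovanskii.eclSubfield T' := fun j => subset_ecl _ (hS'T' (Or.inr ⟨j, rfl⟩))
  -- the closed set `H = Φ(G)` of the model and the transported map `f`
  set H : Set (Khovanskii.eclSubfield T') := {w | ((Φ.symm w : Khovanskii.eclSubfield T) : K) ∈ G}
    with hHdef
  have hHG : ∀ {z : K} (hz : z ∈ G), Φ ⟨z, hGT z hz⟩ ∈ H := fun {z} hz => by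
    change ((Φ.symm (Φ ⟨z, _⟩) : Khovanskii.eclSubfield T) : K) ∈ G
    rw [Φ.symm_apply_apply]; exact hz
  have hH : ecl (∅ ∪ H) = H := by
    rw [Set.empty_union]
    refine Set.Subset.antisymm ?_ (subset_ecl _)
    intro w hw
    -- `Φ⁻¹ w ∈ ecl^{ecl T} (Φ⁻¹ H)` and `Φ⁻¹ H` is the trace of the closed `G`
    have h1 : Φ.symm w ∈ ecl (Φ.symm '' H) := by
      rw [← Khovanskii.image_ecl_equiv]; exact Set.mem_image_of_mem _ hw
    have h2 : ((Φ.symm w : Khovanskii.eclSubfield T) : K) ∈ ecl (Subtype.val '' (Φ.symm '' H)) :=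
      (ZilberTransfer.mem_ecl_sub_iff _ _).1 h1
    have h3 : Subtype.val '' (⇑Φ.symm '' H) ⊆ G := by
      rintro _ ⟨_, ⟨w', hw', rfl⟩, rfl⟩; exact hw'
    change ((Φ.symm w : Khovanskii.eclSubfield T) : K) ∈ G
    rw [← hG]
    exact ecl_mono h3 h2
  have hgT' : ∀ {z : K}, z ∈ G → g z ∈ Khovanskii.eclSubfield T' := fun hz => hG'T' _ hz
  let f : Khovanskii.eclSubfield T' → Khovanskii.eclSubfield T' := fun w =>
    if hw : ((Φ.symm w : Khovanskii.eclSubfield T) : K) ∈ G then ⟨g _, hgT' hw⟩ else w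
  have hf : ∀ {z : K} (hz : z ∈ G), f (Φ ⟨z, hGT z hz⟩) = ⟨g z, hgT' hz⟩ := by
    intro z hz
    have hw : ((Φ.symm (Φ ⟨z, hGT z hz⟩) : Khovanskii.eclSubfield T) : K) ∈ G := by
      rw [Φ.symm_apply_apply]; exact hz
    have e : f (Φ ⟨z, hGT z hz⟩) = ⟨g _, hgT' hw⟩ := by simp only [f, dif_pos hw]
    rw [e]
    all_goals exact Subtype.ext (by simp only [Φ.symm_apply_apply])
  -- every finite tuple from `H` is `Φ a` for a finite tuple `a` from `G`
  have hHform : ∀ {m : ℕ} (s : Fin m → Khovanskii.eclSubfield T'), (∀ i, s i ∈ H) →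
      ∃ (a : Fin m → K) (ha : ∀ i, a i ∈ G), ∀ i, s i = Φ ⟨a i, hGT _ (ha i)⟩ := by
    intro m s hs
    refine ⟨fun i => ((Φ.symm (s i) : Khovanskii.eclSubfield T) : K), fun i => hs i, fun i => ?_⟩
    exact (Φ.apply_symm_apply (s i)).symm.trans (congrArg Φ (Subtype.ext rfl))
  -- the local data: automorphisms over `ecl ∅` matching `Φ (a, x) ↦ (g a, x')`
  set b : Fin n → Khovanskii.eclSubfield T' := fun j => Φ ⟨x j, hxT j⟩ with hb
  set b' : Fin n → Khovanskii.eclSubfield T' := fun j => ⟨x' j, hx'T' j⟩ with hb'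
  have hloc : ∀ ⦃m : ℕ⦄ (s : Fin m → Khovanskii.eclSubfield T'), (∀ i, s i ∈ H) →
      ∃ ρ ∈ SEACModel.baseAut (∅ : Set (Khovanskii.eclSubfield T')), ⇑ρ ∘ s = f ∘ s ∧ ⇑ρ ∘ b = b' := by
    intro m s hs
    obtain ⟨a, ha, hsa⟩ := hHform s hs
    have hu : ∀ j, Fin.append a x j ∈ Khovanskii.eclSubfield T := fun j => by
      refine Fin.addCases (fun i => ?_) (fun i => ?_) j
      · rw [Fin.append_left]; exact hGT _ (ha i)
      · rw [Fin.append_right]; exact hxT i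
    have hu' : ∀ j, Fin.append (g ∘ a) x' j ∈ Khovanskii.eclSubfield T' := fun j => by
      refine Fin.addCases (fun i => ?_) (fun i => ?_) j
      · rw [Fin.append_left]; exact hG'T' _ (ha i)
      · rw [Fin.append_right]; exact hx'T' i
    obtain ⟨ρ, hρ, hρu⟩ := exists_baseAut_of_eclIsoOver Φ hM' hinf' hι hι' hΦ hu hu' (hxx' a ha)
    refine ⟨ρ, hρ, funext fun i => ?_, funext fun j => ?_⟩
    · have e1 : (⟨Fin.append a x (Fin.castAdd n i), hu _⟩ : Khovanskii.eclSubfield T) =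
          ⟨a i, hGT _ (ha i)⟩ := Subtype.ext (by simp)
      have := hρu (Fin.castAdd n i)
      rw [e1] at this
      simp only [Function.comp_apply, hsa i, this, hf (ha i)]
      exact Subtype.ext (by simp)
    · have e1 : (⟨Fin.append a x (Fin.natAdd m j), hu _⟩ : Khovanskii.eclSubfield T) =
          ⟨x j, hxT j⟩ := Subtype.ext (by simp)
      have := hρu (Fin.natAdd m j)
      rw [e1] at this
      simp only [Function.comp_apply, hb, hb', this]
      exact Subtype.ext (by simp)
  -- `Φ y ∈ ecl (H ∪ b)`
  have hya : Φ ⟨y, hyT⟩ ∈ ecl (∅ ∪ (H ∪ Set.range b)) := by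
    rw [Set.empty_union]
    have h1 : (⟨y, hyT⟩ : Khovanskii.eclSubfield T) ∈
        ecl ({z : Khovanskii.eclSubfield T | (z : K) ∈ G} ∪ Set.range fun j => (⟨x j, hxT j⟩ :
          Khovanskii.eclSubfield T)) := by
      rw [ZilberTransfer.mem_ecl_sub_iff, Set.image_union, ZilberTransfer.val_image_range_mk]
      refine ecl_mono (Set.union_subset_union_left _ ?_) hy
      intro z hz; exact ⟨⟨z, hGT z hz⟩, hz, rfl⟩
    have h2 := Set.mem_image_of_mem Φ h1
    rw [Khovanskii.image_ecl_equiv, Set.image_union, ← Set.range_comp] at h2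
    refine ecl_mono (Set.union_subset_union_left _ ?_) h2
    rintro _ ⟨z, hz, rfl⟩
    exact hHG hz
  -- homogeneity over the closed set `H` in the countable model
  obtain ⟨a', ha'⟩ := SEACModel.homogeneity_over_closed hM'.isSurjectiveOntoUnits
    hM'.isStronglyExpAlgClosed hinf' Set.finite_empty hH f hloc hya
  refine ⟨(a' : K'), fun k a ha => ?_⟩
  -- read off the isomorphism of pointed closures for `(a, x, y) ↦ (g a, x', a')`
  obtain ⟨ρ, hρ, hρs, hρb, hρy⟩ := ha' (fun i => Φ ⟨a i, hGT _ (ha i)⟩) (fun i => hHG (ha i))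
  have hu : ∀ j, Fin.append a (Fin.snoc x y : Fin (n + 1) → K) j ∈ Khovanskii.eclSubfield T := by
    intro j
    refine Fin.addCases (fun i => ?_) (fun i => ?_) j
    · rw [Fin.append_left]; exact hGT _ (ha i)
    · rw [Fin.append_right]
      refine Fin.lastCases ?_ (fun i' => ?_) i
      · rw [Fin.snoc_last]; exact hyT
      · rw [Fin.snoc_castSucc]; exact hxT i'
  have hu' : ∀ j, Fin.append (g ∘ a) (Fin.snoc x' (a' : K') : Fin (n + 1) → K') j ∈
      Khovanskii.eclSubfield T' := by
    intro j
    refine Fin.addCases (fun i => ?_) (fun i => ?_) j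
    · rw [Fin.append_left]; exact hG'T' _ (ha i)
    · rw [Fin.append_right]
      refine Fin.lastCases ?_ (fun i' => ?_) i
      · rw [Fin.snoc_last]; exact a'.2
      · rw [Fin.snoc_castSucc]; exact hx'T' i'
  refine eclIsoOver_of_baseAut Φ hι' hΦ hu hu' hρ fun j => ?_
  refine Fin.addCases (fun i => ?_) (fun i => ?_) j
  · have e1 : (⟨Fin.append a (Fin.snoc x y : Fin (n + 1) → K) (Fin.castAdd (n + 1) i), hu _⟩ :
        Khovanskii.eclSubfield T) = ⟨a i, hGT _ (ha i)⟩ := Subtype.ext (by simp)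
    have := congrFun hρs i
    simp only [Function.comp_apply, hf (ha i)] at this
    rw [e1, this]
    exact Subtype.ext (by simp)
  · refine Fin.lastCases ?_ (fun i' => ?_) i
    · have e1 : (⟨Fin.append a (Fin.snoc x y : Fin (n + 1) → K) (Fin.natAdd k (Fin.last n)), hu _⟩ :
          Khovanskii.eclSubfield T) = ⟨y, hyT⟩ :=
        Subtype.ext (by
          show Fin.append a (Fin.snoc x y : Fin (n + 1) → K) (Fin.natAdd k (Fin.last n)) = y
          rw [Fin.append_right, Fin.snoc_last])
      rw [e1, hρy]
      exact Subtype.ext (by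
        show (a' : K') = Fin.append (g ∘ a) (Fin.snoc x' (a' : K') : Fin (n + 1) → K')
          (Fin.natAdd k (Fin.last n))
        rw [Fin.append_right, Fin.snoc_last])
    · have e1 : (⟨Fin.append a (Fin.snoc x y : Fin (n + 1) → K) (Fin.natAdd k (Fin.castSucc i')), hu _⟩ :
          Khovanskii.eclSubfield T) = ⟨x i', hxT i'⟩ := Subtype.ext (by simp)
      have := congrFun hρb i'
      simp only [Function.comp_apply, hb, hb'] at this
      rw [e1, this]
      exact Subtype.ext (by simp)

end Transfer

end ZilberOverUniv

end Literature.NumberTheory.Transcendental
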